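import Literature.Geometry.Kaehler.ComplexTorusKleimanForms
import Literature.Geometry.Kaehler.ComplexTorusHodgeClassesPerfectPairing
import Literature.Geometry.Kaehler.ComplexTorusTranscendentalLatticeAllDegreesHodgeTypes
import HarnessLib

/-!
# Kleiman's forms `B_e(x, *_L y)`, `B_e(x, ∗y)` against the Hodge decomposition of a complex torus: `H^{p,q} ⊥ H^{p',q'}` unless `(p',q') = (q,p)`,
# and on a polarised torus they are NON-DEGENERATE ON THE HODGE CLASSES `Hdgᵖ(X)` (BFNP (6.1) read through `*_L : Hdg^{g-p} ⥲ Hdgᵖ`)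

Layer `Literature/Geometry/Kaehler`, namespace `Literature.Geometry.Kaehler.ComplexTorus`; lane `lit-hodgefound` (Track 2 foundations library),
prover seat `lit-hodgefound-p35` (generation 51, row g51-#3; sequel of rows g51-#1 `ComplexTorusGradedPoincarePairing` — `B_e = poincarePairingG Φ e` —
and g51-#2 `ComplexTorusKleimanForms` — Kleiman's forms `K_L = B_e.compl₂ *_L`, `K_∗ = B_e.compl₂ ∗`). THEOREMS ONLY (no definition, no named fact,
no instance, no notation; D-0026 net debt `0`). Consumed BY NAME: row g50-#6 `lefschetzInvolution_of_apply_mem_typeSubmodule` /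
`hodgeInvolution_of_apply_mem_typeSubmodule` (`*_L`, `∗` reflect the Hodge type `(p,q) ↦ (g-q, g-p)`), `IsNSForm.bijOn_lefschetzInvolution_of_hodgeClasses` /
`…hodgeInvolution…` (`*_L, ∗ : Hdgᵖ ⥲ Hdg^q`), p16's `poincarePairing_eq_zero_of_isOfTypeAt_of_add_ne` (type orthogonality of the cup product), row A4-41
`ComplexTorusHodgeClassesPerfectPairing` (`IsRiemannForm.exists_mem_hodgeClasses_torusIntegral_wedge_ne_zero` / `'`, `IsRiemannForm.eq_hodgeClasses_iff_forall_orthogonal`: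
BFNP (6.1)), `poincarePairing_eq_orientationSign_mul_torusIntegral_wedge` (`⟨·,·⟩_e = ±∫_X`).

## Sources, VERBATIM

* Y. André, *Pour une théorie inconditionnelle des motifs*, Publ. Math. IHÉS 83 (1996) [Andre1996Motifs] (held `paper:doi-10-1007-bf02698643`), §1.1
  (p. 11 = p0008 L5–L10): "sur chacun des espaces `H^{p,q} ∩ Lⁱ P^{j-2i}(X)`, l'opérateur star de Hodge […]; le point important, qui justifie
  l'introduction de `*_H`, est que cet opérateur star et `*_H` ont les mêmes propriétés de positivité sur les cycles réels de type `(p, p)`";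
  Prop. 1.2 (p. 11): "la forme bilinéaire `(x, y) ↦ ∫ x ∪ * y`".
* P. Brosnan, H. Fang, Z. Nie, G. Pearlstein, *Singularities of admissible normal functions*, Invent. Math. 177 (2009) [BrosnanFangNiePearlstein2009],
  §6 (6.1) (held arXiv text `paper:arxiv-0711.0964`, p. 13): "By Poincaré duality and the Hodge-Riemann bilinear relations, the cup product […]
  restricts to a give a perfect pairing `Hdg^k Y ⊗ Hdg^{dim Y - k} Y → ℚ`. Therefore, the Hodge conjecture for `Y` is equivalent to the assertion
  that the perpendicular subspace `(Alg^k Y)^⊥ ⊂ Hdg^{dim Y - k} Y` is zero."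
* C. Voisin, *Hodge Theory and Complex Algebraic Geometry I* (2002) [VoisinHodgeI2002], §7.3.2 Lemma 7.30 (type orthogonality of the cup product),
  §7.2 Lemma 7.26 (proof). S. L. Kleiman, *Algebraic cycles and the Weil conjectures* (1968) [Kleiman1968AlgebraicCycles], §3 (the form
  `⟨x, ∗y⟩` on cycles; via André).

## What is proved (`K_L = (poincarePairingG Φ e).compl₂ *_L`, `K_∗ = (poincarePairingG Φ e).compl₂ ∗`)

* §1 TYPE ORTHOGONALITY (`η` of type `(1,1)`, non-degenerate): **`compl₂_lefschetzInvolution_of_of_eq_zero_of_mem_typeSubmodule`** —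
  `K_L(H^{p,q} ∩ Hᵏ, H^{p',q'} ∩ Hᵏ) = 0` unless `(p', q') = (q, p)` (`*_L H^{p',q'} ⊂ H^{g-q', g-p'}` pairs with `H^{p,q}` only if `p + g - q' = g = q + g - p'`):
  Kleiman's form pairs `H^{p,q}` with `H^{q,p} = conj H^{p,q}` — on the real `(p,p)`-classes it is a genuine bilinear form; the Hodge-class case
  `compl₂_lefschetzInvolution_of_of_eq_zero_of_mem_hodgeClassesIn_of_mem_typeSubmodule` (`Hdg ⊥_{K} H^{p',q'}`, `p' ≠ q'`); the same for `∗`.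
* §2 ON THE HODGE CLASSES OF A POLARISED TORUS (`η` a Riemann form, `e : Fin (2g) ≃ ι`): `IsNSForm.compl₂_lefschetzInvolution_of_of_mem_range_rat_of_mem_hodgeClasses`
  (`K_L(Hdgᵖ, Hdgᵖ) ⊆ ℚ`), **`IsRiemannForm.eq_zero_of_forall_mem_hodgeClasses_compl₂_lefschetzInvolution_eq_zero`** and its second-variable form `'`
  (**`K_L` IS NON-DEGENERATE ON `Hdgᵖ(X)`** for every `p ≤ g`: BFNP's perfect pairing `Hdgᵖ × Hdg^q → ℚ` composed with André's bijection `*_L : Hdg^q ⥲ Hdgᵖ`),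
  **`IsRiemannForm.eq_hodgeClasses_iff_forall_compl₂_lefschetzInvolution_orthogonal`** (BFNP's reformulation IN ONE DEGREE: a subspace `A ≤ Hdgᵖ` —
  "`Alg^p`" — is all of `Hdgᵖ` iff no non-zero Hodge class of `Hdgᵖ` is `K_L`-orthogonal to `A`); the same three for `∗` (normalisation `d = g`).

## Scope / not here

The SIGN of `K_L`, `K_∗` on `H^{p,q} ∩ Lʲ Pᵐ` (Hodge–Riemann; it alternates with `j`, which is André's reason for `*_H`) is not tabulated here — the
positivity of `∫ x ∪ *_H x̄` on real `(p,p)`-classes is row g49-#3. Only invariant forms of complex tori (abelian varieties when polarised).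
-/

noncomputable section

-- `Module ℂ` / `SMulZeroClass ℂ` synthesis on `E [⋀^Fin k]→L[ℝ] ℂ` (as in `ComplexTorusLefschetzDecomposition`)
set_option maxSynthPendingDepth 3

namespace Literature.Geometry.Kaehler

namespace ComplexTorus

open Module Function Finset
open Literature.LinearAlgebra.Alternating Literature.Algebra.Lie Literature.Analysis.Complex

universe uE

variable {ι : Type*} [Fintype ι] [DecidableEq ι] {E : Type uE} [NormedAddCommGroup E] [NormedSpace ℂ E] [FiniteDimensional ℂ E]
  [Nontrivial E] (Φ : (ι → ℝ) ≃L[ℝ] E) {η : E [⋀^Fin 2]→L[ℝ] ℝ} (hη : ∀ v : E, v ≠ 0 → ∃ w : E, η ![v, w] ≠ 0) {N : ℕ}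

/-! ## §1 Kleiman's forms pair `H^{p,q}` with `H^{q,p}` only -/

section Types

omit [Fintype ι] [DecidableEq ι] [Nontrivial E] in
/-- No non-zero forms of type `(p, q)` with `p > g` or `q > g` (the second case by conjugation). [cite: VoisinHodgeI2002, §2.3.1 (2.4)] -/
private theorem eq_zero_of_mem_typeSubmodule_of_finrank_lt {k p q : ℕ} (hpq : p + q = k) {y : E [⋀^Fin k]→L[ℝ] ℂ}
    (hy : y ∈ typeSubmodule E k p q) (h : finrank ℂ E < p ∨ finrank ℂ E < q) : y = 0 := by
  have hT := isOfTypeAt_of_mem_typeSubmodule hpq hy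
  rcases h with h | h
  · exact hT.eq_zero_of_finrank_lt_fst h
  · have h1 := (isOfTypeAt_conjForm hT).eq_zero_of_finrank_lt_fst h
    rw [← conj_conj y, h1]
    ext v
    simp

/-- **KLEIMAN'S FORM PAIRS `H^{p,q}` WITH `H^{q,p}` ONLY: `K_L(of k x, of k y) = 0` for `x ∈ H^{p,q} ∩ Hᵏ`, `y ∈ H^{p',q'} ∩ Hᵏ` with `p' ≠ q`**
(equivalently `(p', q') ≠ (q, p)`; `η` of type `(1,1)` and non-degenerate): `*_L y` has type `(g-q', g-p')` (row g50-#6) and the cup product of types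
`(p, q)`, `(g-q', g-p')` in complementary degrees vanishes unless `p + g - q' = q + g - p'`, i.e. `p' = q` (Voisin's Lemma 7.30). On the REAL classes of type
`(p, p)` the form `K_L(x, y) = K_L(x, ȳ)` is thus André's "`∫ x ∪ *_L x̄`" pairing. [cite: Andre1996Motifs, §1.1 (p. 11) and Prop. 1.2 (p. 11)]
[cite: VoisinHodgeI2002, §7.3.2 Lemma 7.30] -/
theorem compl₂_lefschetzInvolution_of_of_eq_zero_of_mem_typeSubmodule (h11 : ∀ u v : E, η ![Complex.I • u, Complex.I • v] = η ![u, v])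
    (hη : ∀ v : E, v ≠ 0 → ∃ w : E, η ![v, w] ≠ 0) (e : Fin N ≃ ι) {k p q p' q' : ℕ} (hpq : p + q = k) (hpq' : p' + q' = k) (hne : p' ≠ q)
    {x y : E [⋀^Fin k]→L[ℝ] ℂ} (hx : x ∈ typeSubmodule E k p q) (hy : y ∈ typeSubmodule E k p' q') :
    (poincarePairingG Φ e).compl₂ ((hasLefschetzProperty_lefschetzG hη).lefschetzInvolution isZGrading_countingG) (GForm.of k x) (GForm.of k y) = 0 := by
  have hN := finrank_complex_mul_two Φ e
  by_cases hbig : finrank ℂ E < p' ∨ finrank ℂ E < q'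
  · rw [eq_zero_of_mem_typeSubmodule_of_finrank_lt hpq' hy hbig, GForm.of_zero, map_zero]
  · push Not at hbig
    have hkm : k + (2 * finrank ℂ E - k) = 2 * finrank ℂ E := by omega
    rw [compl₂_lefschetzInvolution_of_of Φ hη e (show k + (2 * finrank ℂ E - k) = N by omega)]
    have hsy := lefschetzInvolution_of_apply_mem_typeSubmodule h11 hη hkm hpq' (show (finrank ℂ E - q') + q' = finrank ℂ E by omega)
      (show (finrank ℂ E - p') + p' = finrank ℂ E by omega) hy
    exact poincarePairing_eq_zero_of_isOfTypeAt_of_add_ne Φ e _ (isOfTypeAt_of_mem_typeSubmodule hpq hx)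
      (isOfTypeAt_of_mem_typeSubmodule (by omega) hsy) (by omega)

/-- **`Hdgᵖ-type classes are `K_L`-orthogonal to `H^{p',q'}`, `p' ≠ q'`**: for `x ∈ Hᵏ(X, ℚ) ∩ H^{p,p}` and `y ∈ H^{p',q'} ∩ Hᵏ` with `p' ≠ q'`,
`K_L(of k x, of k y) = 0` (`η ∈ NS(X)` non-degenerate). [cite: Andre1996Motifs, §1.1 (p. 11)] [cite: VoisinHodgeI2002, §7.3.2 Lemma 7.30] -/
theorem IsNSForm.compl₂_lefschetzInvolution_of_of_eq_zero_of_mem_hodgeClassesIn_of_mem_typeSubmodule (hNS : IsNSForm Φ η)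
    (hη : ∀ v : E, v ≠ 0 → ∃ w : E, η ![v, w] ≠ 0) (e : Fin N ≃ ι) {k p p' q' : ℕ} (hpp : p + p = k) (hpq' : p' + q' = k) (hne : p' ≠ q')
    {x y : E [⋀^Fin k]→L[ℝ] ℂ} (hx : x ∈ hodgeClassesIn Φ k p) (hy : y ∈ typeSubmodule E k p' q') :
    (poincarePairingG Φ e).compl₂ ((hasLefschetzProperty_lefschetzG hη).lefschetzInvolution isZGrading_countingG) (GForm.of k x) (GForm.of k y) = 0 :=
  compl₂_lefschetzInvolution_of_of_eq_zero_of_mem_typeSubmodule Φ hNS.type_one_one hη e hpp hpq' (fun h ↦ hne (by omega)) hx.2 hy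

/-- **The same for `∗`: `K_∗(of k x, of k y) = 0` for `x ∈ H^{p,q}`, `y ∈ H^{p',q'}`, `p' ≠ q`** (normalisation `d = g`; `∗` reflects the type like `*_L`).
[cite: Milne1999LefschetzClasses, §5 p. 664] [cite: VoisinHodgeI2002, §7.3.2 Lemma 7.30] -/
theorem compl₂_hodgeInvolution_of_of_eq_zero_of_mem_typeSubmodule (h11 : ∀ u v : E, η ![Complex.I • u, Complex.I • v] = η ![u, v])
    (hη : ∀ v : E, v ≠ 0 → ∃ w : E, η ![v, w] ≠ 0) (e : Fin N ≃ ι) {k p q p' q' : ℕ} (hpq : p + q = k) (hpq' : p' + q' = k) (hne : p' ≠ q)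
    {x y : E [⋀^Fin k]→L[ℝ] ℂ} (hx : x ∈ typeSubmodule E k p q) (hy : y ∈ typeSubmodule E k p' q') :
    (poincarePairingG Φ e).compl₂ ((hasLefschetzProperty_lefschetzG hη).hodgeInvolution isZGrading_countingG (finrank ℂ E)) (GForm.of k x)
      (GForm.of k y) = 0 := by
  have hN := finrank_complex_mul_two Φ e
  by_cases hbig : finrank ℂ E < p' ∨ finrank ℂ E < q'
  · rw [eq_zero_of_mem_typeSubmodule_of_finrank_lt hpq' hy hbig, GForm.of_zero, map_zero]
  · push Not at hbig
    have hkm : k + (2 * finrank ℂ E - k) = 2 * finrank ℂ E := by omega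
    rw [compl₂_hodgeInvolution_of_of Φ hη e _ (show k + (2 * finrank ℂ E - k) = N by omega)]
    have hsy := hodgeInvolution_of_apply_mem_typeSubmodule h11 hη hkm hpq' (show (finrank ℂ E - q') + q' = finrank ℂ E by omega)
      (show (finrank ℂ E - p') + p' = finrank ℂ E by omega) hy
    exact poincarePairing_eq_zero_of_isOfTypeAt_of_add_ne Φ e _ (isOfTypeAt_of_mem_typeSubmodule hpq hx)
      (isOfTypeAt_of_mem_typeSubmodule (by omega) hsy) (by omega)

end Types

/-! ## §2 On a polarised torus Kleiman's forms are non-degenerate on the Hodge classes `Hdgᵖ(X)` -/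

section HodgeClasses

/-- **`K_L(Hdgᵖ, Hdgᵖ) ⊆ ℚ`**: for Hodge classes `x, y ∈ Hdgᵖ(X) = H^{2p}(X, ℚ) ∩ H^{p,p}`, `K_L(of x, of y)` is a rational number (`η ∈ NS(X)` non-degenerate;
`*_L` is defined over `ℚ`). [cite: Andre1996Motifs, Prop. 1.2 (p. 11, "`ℚ[L, *_L]` […] de `End H*(X)`")] [cite: Milne1999LefschetzClasses, §5 p. 665] -/
theorem IsNSForm.compl₂_lefschetzInvolution_of_of_mem_range_rat_of_mem_hodgeClasses (hNS : IsNSForm Φ η) (hη : ∀ v : E, v ≠ 0 → ∃ w : E, η ![v, w] ≠ 0)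
    (e : Fin N ≃ ι) {p : ℕ} {x y : E [⋀^Fin (2 * p)]→L[ℝ] ℂ} (hx : x ∈ hodgeClasses Φ p) (hy : y ∈ hodgeClasses Φ p) :
    ∃ q : ℚ, (poincarePairingG Φ e).compl₂ ((hasLefschetzProperty_lefschetzG hη).lefschetzInvolution isZGrading_countingG)
      (GForm.of (2 * p) x) (GForm.of (2 * p) y) = q :=
  hNS.compl₂_lefschetzInvolution_mem_range_rat Φ hη e (of_mem_rationalFormsG Φ hx.1) (of_mem_rationalFormsG Φ hy.1)

omit [Fintype ι] [FiniteDimensional ℂ E] [Nontrivial E] in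
/-- The orientation sign of a frame is a unit (plumbing). [cite: Lange2023AbelianVarietiesComplex, §6.2.4 (p. 310)] -/
private theorem orientationSign_cast_ne_zero₅₁ {n : ℕ} (e' : Fin n ≃ ι) : (orientationSign Φ e' : ℂ) ≠ 0 := by
  rcases orientationSign_eq_or Φ e' with hs | hs <;> rw [hs] <;> norm_num

/-- **KLEIMAN'S FORM IS NON-DEGENERATE ON THE HODGE CLASSES `Hdgᵖ(X)` OF A POLARISED COMPLEX TORUS** (`η` a Riemann form, `p + q = g`): if `x ∈ Hdgᵖ` and
`K_L(of x, of y) = 0` for all `y ∈ Hdgᵖ`, then `x = 0`. BFNP (6.1): the cup product `Hdgᵖ × Hdg^q → ℚ` is perfect (Poincaré duality + Hodge–Riemann,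
row A4-41); and `y ↦ (*_L y)_{2q}` is André's bijection `Hdgᵖ ⥲ Hdg^q` (row g50-#6), so `K_L(x, y) = ±∫_X x ∧ *_L y` runs through all of `⟨x, Hdg^q⟩`.
[cite: BrosnanFangNiePearlstein2009, §6 (6.1)] [cite: Andre1996Motifs, §1.1 (p. 11) and Prop. 1.2 (p. 11)] [cite: VoisinHodgeI2002, §7.2 Lemma 7.26 (proof)] -/
theorem IsRiemannForm.eq_zero_of_forall_mem_hodgeClasses_compl₂_lefschetzInvolution_eq_zero (hR : IsRiemannForm Φ η)
    (hη : ∀ v : E, v ≠ 0 → ∃ w : E, η ![v, w] ≠ 0) {g : ℕ} (e : Fin (2 * g) ≃ ι) {p q : ℕ} (hpq : p + q = g) {x : E [⋀^Fin (2 * p)]→L[ℝ] ℂ}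
    (hx : x ∈ hodgeClasses Φ p)
    (h0 : ∀ y ∈ hodgeClasses Φ p, (poincarePairingG Φ e).compl₂ ((hasLefschetzProperty_lefschetzG hη).lefschetzInvolution isZGrading_countingG)
      (GForm.of (2 * p) x) (GForm.of (2 * p) y) = 0) : x = 0 := by
  have hg : finrank ℂ E = g := finrank_eq_of_finTwoMulEquiv Φ e
  have hNS : IsNSForm Φ η := hR.isNSForm Φ
  have h2 : 2 * p + 2 * q = 2 * g := by omega
  by_contra hx0
  obtain ⟨z, hz, hI⟩ := hR.exists_mem_hodgeClasses_torusIntegral_wedge_ne_zero Φ e hpq h2 hx hx0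
  set L := hasLefschetzProperty_lefschetzG hη with hL
  -- `y := (*_L z)_{2p} ∈ Hdgᵖ`, and `(*_L y)_{2q} = z`
  have hy : L.lefschetzInvolution isZGrading_countingG (GForm.of (2 * q) z) (2 * p) ∈ hodgeClasses Φ p :=
    (hNS.bijOn_lefschetzInvolution_of_hodgeClasses Φ hη (show q + p = finrank ℂ E by omega)).mapsTo hz
  have h1 := h0 _ hy
  rw [compl₂_lefschetzInvolution_of_of Φ hη e h2, ← lefschetzInvolution_of_eq_of hη (show 2 * q + 2 * p = 2 * finrank ℂ E by omega) z,
    L.lefschetzInvolution_lefschetzInvolution isZGrading_countingG, GForm.of_apply_self, poincarePairing_eq_orientationSign_mul_torusIntegral_wedge,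
    torusIntegral_finCongr_trans, mul_eq_zero] at h1
  rcases h1 with h1 | h1
  · exact orientationSign_cast_ne_zero₅₁ Φ _ h1
  · exact hI h1

/-- **Non-degeneracy on `Hdgᵖ(X)` in the second variable**: `K_L(of y, of x) = 0` for all `y ∈ Hdgᵖ` forces `x = 0` (`K_L` is symmetric on the even class `x`).
[cite: BrosnanFangNiePearlstein2009, §6 (6.1)] [cite: Andre1996Motifs, Prop. 1.2 (p. 11)] -/
theorem IsRiemannForm.eq_zero_of_forall_mem_hodgeClasses_compl₂_lefschetzInvolution_eq_zero' (hR : IsRiemannForm Φ η)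
    (hη : ∀ v : E, v ≠ 0 → ∃ w : E, η ![v, w] ≠ 0) {g : ℕ} (e : Fin (2 * g) ≃ ι) {p q : ℕ} (hpq : p + q = g) {x : E [⋀^Fin (2 * p)]→L[ℝ] ℂ}
    (hx : x ∈ hodgeClasses Φ p)
    (h0 : ∀ y ∈ hodgeClasses Φ p, (poincarePairingG Φ e).compl₂ ((hasLefschetzProperty_lefschetzG hη).lefschetzInvolution isZGrading_countingG)
      (GForm.of (2 * p) y) (GForm.of (2 * p) x) = 0) : x = 0 := by
  refine hR.eq_zero_of_forall_mem_hodgeClasses_compl₂_lefschetzInvolution_eq_zero Φ hη e hpq hx fun y hy ↦ ?_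
  have h1 := h0 y hy
  rwa [compl₂_lefschetzInvolution_of_of_comm Φ hη e, (even_two_mul p).neg_one_pow, one_mul] at h1

/-- **BFNP'S REFORMULATION IN ONE DEGREE, through Kleiman's form**: on a polarised complex torus, a `ℚ`-subspace `A ≤ Hdgᵖ(X)` ("`Alg^p X`") is ALL of
`Hdgᵖ(X)` iff no non-zero Hodge class `y ∈ Hdgᵖ(X)` is `K_L`-orthogonal to `A` ("the Hodge conjecture for `Y` is equivalent to the assertion that the
perpendicular subspace `(Alg^k Y)^⊥ […]` is zero", with `Hdg^{g-p}` replaced by `Hdgᵖ` along `*_L : Hdgᵖ ⥲ Hdg^{g-p}`). [cite: BrosnanFangNiePearlstein2009, §6 (6.1) and the sentence following it]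
[cite: Andre1996Motifs, §1.1 (p. 11) and Prop. 1.2 (p. 11)] -/
theorem IsRiemannForm.eq_hodgeClasses_iff_forall_compl₂_lefschetzInvolution_orthogonal (hR : IsRiemannForm Φ η)
    (hη : ∀ v : E, v ≠ 0 → ∃ w : E, η ![v, w] ≠ 0) {g : ℕ} (e : Fin (2 * g) ≃ ι) {p q : ℕ} (hpq : p + q = g)
    {A : Submodule ℚ (E [⋀^Fin (2 * p)]→L[ℝ] ℂ)} (hA : A ≤ hodgeClasses Φ p) :
    A = hodgeClasses Φ p ↔
      ∀ y ∈ hodgeClasses Φ p, (∀ x ∈ A, (poincarePairingG Φ e).compl₂ ((hasLefschetzProperty_lefschetzG hη).lefschetzInvolution isZGrading_countingG)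
        (GForm.of (2 * p) x) (GForm.of (2 * p) y) = 0) → y = 0 := by
  have hg : finrank ℂ E = g := finrank_eq_of_finTwoMulEquiv Φ e
  have hNS : IsNSForm Φ η := hR.isNSForm Φ
  have h2 : 2 * p + 2 * q = 2 * g := by omega
  set L := hasLefschetzProperty_lefschetzG hη with hL
  have hbij := hNS.bijOn_lefschetzInvolution_of_hodgeClasses Φ hη (show p + q = finrank ℂ E by omega)
  have hbij' := hNS.bijOn_lefschetzInvolution_of_hodgeClasses Φ hη (show q + p = finrank ℂ E by omega)
  -- `K_L(of x, of y) = ± ∫_X x ∧ (*_L y)_{2q}`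
  have hK : ∀ x y : E [⋀^Fin (2 * p)]→L[ℝ] ℂ,
      (poincarePairingG Φ e).compl₂ (L.lefschetzInvolution isZGrading_countingG) (GForm.of (2 * p) x) (GForm.of (2 * p) y) =
        orientationSign Φ ((finCongr h2).trans e) *
          torusIntegral Φ e ((x.wedge (L.lefschetzInvolution isZGrading_countingG (GForm.of (2 * p) y) (2 * q))).domDomCongr (finCongr h2)) := by
    intro x y
    rw [compl₂_lefschetzInvolution_of_of Φ hη e h2, poincarePairing_eq_orientationSign_mul_torusIntegral_wedge, torusIntegral_finCongr_trans]
  rw [hR.eq_hodgeClasses_iff_forall_orthogonal Φ e hpq h2 hA]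
  constructor
  · intro H y hy hyo
    -- `z := (*_L y)_{2q} ∈ Hdg^q` is `∫`-orthogonal to `A`, hence `0`, hence `y = 0`
    have hz : L.lefschetzInvolution isZGrading_countingG (GForm.of (2 * p) y) (2 * q) ∈ hodgeClasses Φ q := hbij.mapsTo hy
    have hz0 := H _ hz fun x hx ↦ by
      have h1 := hyo x hx
      rw [hK, mul_eq_zero] at h1
      exact h1.resolve_left (orientationSign_cast_ne_zero₅₁ Φ _)
    have h3 := lefschetzInvolution_of_eq_of hη (show 2 * p + 2 * q = 2 * finrank ℂ E by omega) y
    rw [hz0, GForm.of_zero] at h3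
    have h4 := congrArg (fun w ↦ L.lefschetzInvolution isZGrading_countingG w (2 * p)) h3
    simp only [L.lefschetzInvolution_lefschetzInvolution isZGrading_countingG, GForm.of_apply_self, map_zero, Pi.zero_apply] at h4
    exact h4
  · intro H z hz hzo
    -- `y := (*_L z)_{2p} ∈ Hdgᵖ` is `K_L`-orthogonal to `A`, hence `0`, hence `z = 0`
    have hy : L.lefschetzInvolution isZGrading_countingG (GForm.of (2 * q) z) (2 * p) ∈ hodgeClasses Φ p := hbij'.mapsTo hz
    have hy0 := H _ hy fun x hx ↦ by
      rw [hK, ← lefschetzInvolution_of_eq_of hη (show 2 * q + 2 * p = 2 * finrank ℂ E by omega) z,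
        L.lefschetzInvolution_lefschetzInvolution isZGrading_countingG, GForm.of_apply_self, hzo x hx, mul_zero]
    have h3 := lefschetzInvolution_of_eq_of hη (show 2 * q + 2 * p = 2 * finrank ℂ E by omega) z
    rw [hy0, GForm.of_zero] at h3
    have h4 := congrArg (fun w ↦ L.lefschetzInvolution isZGrading_countingG w (2 * q)) h3
    simp only [L.lefschetzInvolution_lefschetzInvolution isZGrading_countingG, GForm.of_apply_self, map_zero, Pi.zero_apply] at h4
    exact h4

/-- **`K_∗(Hdgᵖ, Hdgᵖ) ⊆ ℚ`** (Kleiman–Milne's `∗`, `d = g`, `η ∈ NS(X)` non-degenerate). [cite: Milne1999LefschetzClasses, §5 p. 665 (proof of Thm. 5.9)] -/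
theorem IsNSForm.compl₂_hodgeInvolution_of_of_mem_range_rat_of_mem_hodgeClasses (hNS : IsNSForm Φ η) (hη : ∀ v : E, v ≠ 0 → ∃ w : E, η ![v, w] ≠ 0)
    (e : Fin N ≃ ι) {p : ℕ} {x y : E [⋀^Fin (2 * p)]→L[ℝ] ℂ} (hx : x ∈ hodgeClasses Φ p) (hy : y ∈ hodgeClasses Φ p) :
    ∃ q : ℚ, (poincarePairingG Φ e).compl₂ ((hasLefschetzProperty_lefschetzG hη).hodgeInvolution isZGrading_countingG (finrank ℂ E))
      (GForm.of (2 * p) x) (GForm.of (2 * p) y) = q :=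
  hNS.compl₂_hodgeInvolution_mem_range_rat Φ hη e (of_mem_rationalFormsG Φ hx.1) (of_mem_rationalFormsG Φ hy.1)

/-- **`K_∗` IS NON-DEGENERATE ON `Hdgᵖ(X)`** (polarised torus, `p + q = g`, `∗` normalised by `d = g`; `∗ : Hdgᵖ ⥲ Hdg^q`, row g50-#6).
[cite: BrosnanFangNiePearlstein2009, §6 (6.1)] [cite: Milne1999LefschetzClasses, §5 Thm. 5.9] -/
theorem IsRiemannForm.eq_zero_of_forall_mem_hodgeClasses_compl₂_hodgeInvolution_eq_zero (hR : IsRiemannForm Φ η)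
    (hη : ∀ v : E, v ≠ 0 → ∃ w : E, η ![v, w] ≠ 0) {g : ℕ} (e : Fin (2 * g) ≃ ι) {p q : ℕ} (hpq : p + q = g) {x : E [⋀^Fin (2 * p)]→L[ℝ] ℂ}
    (hx : x ∈ hodgeClasses Φ p)
    (h0 : ∀ y ∈ hodgeClasses Φ p, (poincarePairingG Φ e).compl₂ ((hasLefschetzProperty_lefschetzG hη).hodgeInvolution isZGrading_countingG (finrank ℂ E))
      (GForm.of (2 * p) x) (GForm.of (2 * p) y) = 0) : x = 0 := by
  have hg : finrank ℂ E = g := finrank_eq_of_finTwoMulEquiv Φ e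
  have hNS : IsNSForm Φ η := hR.isNSForm Φ
  have h2 : 2 * p + 2 * q = 2 * g := by omega
  by_contra hx0
  obtain ⟨z, hz, hI⟩ := hR.exists_mem_hodgeClasses_torusIntegral_wedge_ne_zero Φ e hpq h2 hx hx0
  set L := hasLefschetzProperty_lefschetzG hη with hL
  have hy : L.hodgeInvolution isZGrading_countingG (finrank ℂ E) (GForm.of (2 * q) z) (2 * p) ∈ hodgeClasses Φ p :=
    (hNS.bijOn_hodgeInvolution_of_hodgeClasses Φ hη (show q + p = finrank ℂ E by omega)).mapsTo hz
  have h1 := h0 _ hy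
  rw [compl₂_hodgeInvolution_of_of Φ hη e _ h2, ← hodgeInvolution_of_eq_of hη _ (show 2 * q + 2 * p = 2 * finrank ℂ E by omega) z,
    L.hodgeInvolution_hodgeInvolution isZGrading_countingG, GForm.of_apply_self, poincarePairing_eq_orientationSign_mul_torusIntegral_wedge,
    torusIntegral_finCongr_trans, mul_eq_zero] at h1
  rcases h1 with h1 | h1
  · exact orientationSign_cast_ne_zero₅₁ Φ _ h1
  · exact hI h1

/-- **Non-degeneracy of `K_∗` on `Hdgᵖ(X)` in the second variable.** [cite: BrosnanFangNiePearlstein2009, §6 (6.1)] [cite: Milne1999LefschetzClasses, §5 Thm. 5.9] -/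
theorem IsRiemannForm.eq_zero_of_forall_mem_hodgeClasses_compl₂_hodgeInvolution_eq_zero' (hR : IsRiemannForm Φ η)
    (hη : ∀ v : E, v ≠ 0 → ∃ w : E, η ![v, w] ≠ 0) {g : ℕ} (e : Fin (2 * g) ≃ ι) {p q : ℕ} (hpq : p + q = g) {x : E [⋀^Fin (2 * p)]→L[ℝ] ℂ}
    (hx : x ∈ hodgeClasses Φ p)
    (h0 : ∀ y ∈ hodgeClasses Φ p, (poincarePairingG Φ e).compl₂ ((hasLefschetzProperty_lefschetzG hη).hodgeInvolution isZGrading_countingG (finrank ℂ E))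
      (GForm.of (2 * p) y) (GForm.of (2 * p) x) = 0) : x = 0 := by
  refine hR.eq_zero_of_forall_mem_hodgeClasses_compl₂_hodgeInvolution_eq_zero Φ hη e hpq hx fun y hy ↦ ?_
  have h1 := h0 y hy
  rwa [compl₂_hodgeInvolution_apply_of_comm Φ hη e, (even_two_mul p).neg_one_pow, one_mul] at h1

/-- **BFNP's reformulation in one degree, through `K_∗`**: `A ≤ Hdgᵖ` is all of `Hdgᵖ` iff no non-zero `y ∈ Hdgᵖ` is `K_∗`-orthogonal to `A`.
[cite: BrosnanFangNiePearlstein2009, §6 (6.1) and the sentence following it] [cite: Milne1999LefschetzClasses, §5 Thm. 5.9] -/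
theorem IsRiemannForm.eq_hodgeClasses_iff_forall_compl₂_hodgeInvolution_orthogonal (hR : IsRiemannForm Φ η)
    (hη : ∀ v : E, v ≠ 0 → ∃ w : E, η ![v, w] ≠ 0) {g : ℕ} (e : Fin (2 * g) ≃ ι) {p q : ℕ} (hpq : p + q = g)
    {A : Submodule ℚ (E [⋀^Fin (2 * p)]→L[ℝ] ℂ)} (hA : A ≤ hodgeClasses Φ p) :
    A = hodgeClasses Φ p ↔
      ∀ y ∈ hodgeClasses Φ p, (∀ x ∈ A, (poincarePairingG Φ e).compl₂ ((hasLefschetzProperty_lefschetzG hη).hodgeInvolution isZGrading_countingG (finrank ℂ E))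
        (GForm.of (2 * p) x) (GForm.of (2 * p) y) = 0) → y = 0 := by
  have hg : finrank ℂ E = g := finrank_eq_of_finTwoMulEquiv Φ e
  have hNS : IsNSForm Φ η := hR.isNSForm Φ
  have h2 : 2 * p + 2 * q = 2 * g := by omega
  set L := hasLefschetzProperty_lefschetzG hη with hL
  have hbij := hNS.bijOn_hodgeInvolution_of_hodgeClasses Φ hη (show p + q = finrank ℂ E by omega)
  have hbij' := hNS.bijOn_hodgeInvolution_of_hodgeClasses Φ hη (show q + p = finrank ℂ E by omega)
  have hK : ∀ x y : E [⋀^Fin (2 * p)]→L[ℝ] ℂ,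
      (poincarePairingG Φ e).compl₂ (L.hodgeInvolution isZGrading_countingG (finrank ℂ E)) (GForm.of (2 * p) x) (GForm.of (2 * p) y) =
        orientationSign Φ ((finCongr h2).trans e) *
          torusIntegral Φ e ((x.wedge (L.hodgeInvolution isZGrading_countingG (finrank ℂ E) (GForm.of (2 * p) y) (2 * q))).domDomCongr (finCongr h2)) := by
    intro x y
    rw [compl₂_hodgeInvolution_of_of Φ hη e _ h2, poincarePairing_eq_orientationSign_mul_torusIntegral_wedge, torusIntegral_finCongr_trans]
  rw [hR.eq_hodgeClasses_iff_forall_orthogonal Φ e hpq h2 hA]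
  constructor
  · intro H y hy hyo
    have hz : L.hodgeInvolution isZGrading_countingG (finrank ℂ E) (GForm.of (2 * p) y) (2 * q) ∈ hodgeClasses Φ q := hbij.mapsTo hy
    have hz0 := H _ hz fun x hx ↦ by
      have h1 := hyo x hx
      rw [hK, mul_eq_zero] at h1
      exact h1.resolve_left (orientationSign_cast_ne_zero₅₁ Φ _)
    have h3 := hodgeInvolution_of_eq_of hη (finrank ℂ E) (show 2 * p + 2 * q = 2 * finrank ℂ E by omega) y
    rw [hz0, GForm.of_zero] at h3
    have h4 := congrArg (fun w ↦ L.hodgeInvolution isZGrading_countingG (finrank ℂ E) w (2 * p)) h3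
    simp only [L.hodgeInvolution_hodgeInvolution isZGrading_countingG, GForm.of_apply_self, map_zero, Pi.zero_apply] at h4
    exact h4
  · intro H z hz hzo
    have hy : L.hodgeInvolution isZGrading_countingG (finrank ℂ E) (GForm.of (2 * q) z) (2 * p) ∈ hodgeClasses Φ p := hbij'.mapsTo hz
    have hy0 := H _ hy fun x hx ↦ by
      rw [hK, ← hodgeInvolution_of_eq_of hη _ (show 2 * q + 2 * p = 2 * finrank ℂ E by omega) z,
        L.hodgeInvolution_hodgeInvolution isZGrading_countingG, GForm.of_apply_self, hzo x hx, mul_zero]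
    have h3 := hodgeInvolution_of_eq_of hη (finrank ℂ E) (show 2 * q + 2 * p = 2 * finrank ℂ E by omega) z
    rw [hy0, GForm.of_zero] at h3
    have h4 := congrArg (fun w ↦ L.hodgeInvolution isZGrading_countingG (finrank ℂ E) w (2 * q)) h3
    simp only [L.hodgeInvolution_hodgeInvolution isZGrading_countingG, GForm.of_apply_self, map_zero, Pi.zero_apply] at h4
    exact h4

end HodgeClasses

end ComplexTorus

end Literature.Geometry.Kaehler

end
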